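import Summits.QuantumFields.GaugeBoot.ClassB
import Mathlib.MeasureTheory.Function.ContinuousMapDense
import HarnessLib

/-!
# Bounded measurable half-space observables are `L²`-limits of continuous cylinder ones
(gauge-boot, Class-B identification: the density step)

HONEST FRAMING (cell `pub-gaugeboot`, page 1 of every file): the venture produces certified bounds
on lattice expectations at stated coupling, gauge group, dimension and torus size; NOT a mass gap,
NOT a continuum limit, NOT a string tension; NOT Yang–Mills-summit-bearing (barriers
`FixedCouplingUltralocality`, `PerturbativeInvisibility`).

The reflection-positivity fields of `ClassBState` (`ClassB.lean`) quantify over bounded MEASURABLE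
observables depending on the links of a half-space `S`, whereas infinite-volume limit points are
defined through bounded CONTINUOUS CYLINDER observables. This file bridges the two:

* `exists_finite_uniform_approx` — a continuous real function on a compact product `ι → G` is
  uniformly approximated by one depending on finitely many coordinates (the others frozen);
* `exists_continuous_cylinder_eLpNorm_sub_le` — for a probability measure `μ` on `LGConfig d G`
  (`G` compact, second countable, Hausdorff), a bounded measurable real `F` with `DependsOn F S`,
  and `ε ≠ 0`, there is a bounded continuous cylinder observable `g` (finite support `T`), still
  with `DependsOn g S`, such that `eLpNorm (F - g) 2 μ ≤ ε`.

Proof of the second: pass to the marginal `μ_S = μ ∘ (S.restrict)⁻¹` on the compact metrisable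
space `S → G` (`setGlue` is a measurable section of the restriction); there bounded measurable
functions are `L²`-limits of bounded continuous ones (Mathlib
`MemLp.exists_boundedContinuous_eLpNorm_sub_le`: finite Borel measures on metrisable spaces are
weakly regular) and bounded continuous ones are uniform limits of finitely supported ones (first
bullet); the two steps are combined by `MemLp.induction_dense` and pulled back along `S.restrict`.

References: H.-O. Georgii, Gibbs Measures and Phase Transitions (2011), §4.3; standard.
-/

noncomputable section

open MeasureTheory Filter Topology
open scoped ENNReal
open Literature.MathematicalPhysics.QuantumLattice

namespace Summit.QuantumFields.GaugeBoot

variable {d : ℕ} {G : Type*}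

/-! ## Gluing along a set of links; the restriction to `S` -/

section Glue

variable (S : Set (ZdEdge d))

open Classical in
/-- Glue a configuration `V` of the links of `S` with `η` off `S`. -/
def setGlue (V : ↥S → G) (η : LGConfig d G) : LGConfig d G :=
  fun e => if h : e ∈ S then V ⟨e, h⟩ else η e

/-- On `S` the glued configuration is `V`. -/
theorem setGlue_apply_mem (V : ↥S → G) (η : LGConfig d G) {e : ZdEdge d} (he : e ∈ S) :
    setGlue S V η e = V ⟨e, he⟩ := by
  simp [setGlue, he]

/-- Restricting a glued configuration to `S` returns `V`. -/
@[simp] theorem restrict_setGlue (V : ↥S → G) (η : LGConfig d G) : S.restrict (setGlue S V η) = V := by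
  funext e
  exact setGlue_apply_mem S V η e.2

/-- An `S`-supported observable factors through the restriction to `S`. -/
theorem apply_setGlue_restrict {α : Type*} {F : LGConfig d G → α} (hF : DependsOn F S)
    (η U : LGConfig d G) : F (setGlue S (S.restrict U) η) = F U :=
  hF fun _ he => setGlue_apply_mem S _ η he

variable [MeasurableSpace G]

/-- Gluing is measurable in the inner configuration. -/
theorem measurable_setGlue (η : LGConfig d G) : Measurable fun V : ↥S → G => setGlue S V η := by
  refine measurable_pi_iff.2 fun e => ?_
  by_cases he : e ∈ S
  · simp only [setGlue, he, ↓reduceDIte]; exact measurable_pi_apply _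
  · simp only [setGlue, he, ↓reduceDIte]; exact measurable_const

/-- Restriction to the links of `S` is measurable. -/
theorem measurable_setRestrict : Measurable (S.restrict : LGConfig d G → (↥S → G)) :=
  measurable_pi_iff.2 fun e => measurable_pi_apply (e : ZdEdge d)

end Glue

/-! ## Uniform approximation by finitely supported functions on a compact product -/

section Uniform

variable {ι : Type*} [TopologicalSpace G] [CompactSpace G]

/-- **A continuous real function on the compact product `ι → G` is uniformly approximated by a
function of finitely many coordinates** (the other coordinates frozen at `η`): cover the product by
finitely many basic open boxes on which `g` oscillates by `< δ/2`. -/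
theorem exists_finite_uniform_approx [DecidableEq ι] {g : (ι → G) → ℝ} (hg : Continuous g)
    (η : ι → G) {δ : ℝ} (hδ : 0 < δ) :
    ∃ I : Finset ι, ∀ a : ι → G, |g a - g (fun i => if i ∈ I then a i else η i)| < δ := by
  have key : ∀ a : ι → G, ∃ I : Finset ι, ∃ u : ι → Set G, (∀ i ∈ I, IsOpen (u i) ∧ a i ∈ u i) ∧
      ∀ b ∈ (I : Set ι).pi u, |g b - g a| < δ / 2 := by
    intro a
    have ho : IsOpen (g ⁻¹' Metric.ball (g a) (δ / 2)) := hg.isOpen_preimage _ Metric.isOpen_ball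
    have ha : a ∈ g ⁻¹' Metric.ball (g a) (δ / 2) := Metric.mem_ball_self (by linarith)
    obtain ⟨I, u, hu, hsub⟩ := isOpen_pi_iff.1 ho a ha
    refine ⟨I, u, hu, fun b hb => ?_⟩
    have := hsub hb
    rwa [Set.mem_preimage, Metric.mem_ball, Real.dist_eq] at this
  choose I u hu hball using key
  have hcover : (Set.univ : Set (ι → G)) ⊆ ⋃ a, (I a : Set ι).pi (u a) :=
    fun b _ => Set.mem_iUnion.2 ⟨b, fun i hi => (hu b i hi).2⟩
  obtain ⟨t, ht⟩ := isCompact_univ.elim_finite_subcover (fun a => (I a : Set ι).pi (u a))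
    (fun a => isOpen_set_pi (I a).finite_toSet fun i hi => (hu a i hi).1) hcover
  refine ⟨t.biUnion I, fun b => ?_⟩
  obtain ⟨a, hat, hb⟩ : ∃ a ∈ t, b ∈ (I a : Set ι).pi (u a) := by
    simpa only [Set.mem_iUnion, exists_prop] using ht (Set.mem_univ b)
  have hb' : (fun i => if i ∈ t.biUnion I then b i else η i) ∈ (I a : Set ι).pi (u a) := by
    intro i hi
    have hmem : i ∈ t.biUnion I := Finset.mem_biUnion.2 ⟨a, hat, hi⟩
    simp only [hmem, ↓reduceIte]
    exact hb i hi
  have h1 := hball a b hb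
  have h2 := hball a _ hb'
  rw [abs_sub_comm] at h2
  calc |g b - g (fun i => if i ∈ t.biUnion I then b i else η i)|
      ≤ |g b - g a| + |g a - g (fun i => if i ∈ t.biUnion I then b i else η i)| := abs_sub_le _ _ _
    _ < δ / 2 + δ / 2 := add_lt_add h1 h2
    _ = δ := by ring

end Uniform

/-! ## The density theorem -/

section Density

variable [Group G] [TopologicalSpace G] [IsTopologicalGroup G] [CompactSpace G] [T2Space G]
  [SecondCountableTopology G] [MeasurableSpace G] [BorelSpace G]

/-- The class of approximants on the marginal space `S → G`: bounded continuous functions of finitely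
many coordinates. -/
def IsFinCylinder (S : Set (ZdEdge d)) (g : (↥S → G) → ℝ) : Prop :=
  (∃ I : Finset ↥S, DependsOn g (I : Set ↥S)) ∧ Continuous g ∧ ∃ C : ℝ, ∀ a, |g a| ≤ C

omit [Group G] [IsTopologicalGroup G] [CompactSpace G] [T2Space G] [SecondCountableTopology G]
  [MeasurableSpace G] [BorelSpace G] in
/-- The approximant class is closed under addition. -/
theorem IsFinCylinder.add {S : Set (ZdEdge d)} {f g : (↥S → G) → ℝ} (hf : IsFinCylinder S f)
    (hg : IsFinCylinder S g) : IsFinCylinder S (f + g) := by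
  classical
  obtain ⟨⟨I, hI⟩, hfc, Cf, hCf⟩ := hf
  obtain ⟨⟨J, hJ⟩, hgc, Cg, hCg⟩ := hg
  refine ⟨⟨I ∪ J, fun a b hab => ?_⟩, hfc.add hgc, Cf + Cg, fun a => ?_⟩
  · simp only [Pi.add_apply]
    rw [hI fun i hi => hab i (by simp [Finset.mem_coe.1 hi]),
      hJ fun i hi => hab i (by simp [Finset.mem_coe.1 hi])]
  · exact (abs_add_le _ _).trans (add_le_add (hCf a) (hCg a))

/-- **Step on the marginal space**: indicators (times constants) are `L²(ν)`-approximated by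
bounded continuous finitely supported functions, for every Borel probability measure `ν` on
`S → G`. -/
theorem exists_isFinCylinder_indicator_approx (S : Set (ZdEdge d)) (ν : Measure (↥S → G))
    [IsProbabilityMeasure ν] (c : ℝ) {s : Set (↥S → G)} (hs : MeasurableSet s) {ε : ℝ≥0∞} (hε : ε ≠ 0) :
    ∃ g : (↥S → G) → ℝ, eLpNorm (g - s.indicator fun _ => c) 2 ν ≤ ε ∧ IsFinCylinder S g := by
  classical
  have hε2 : ε / 2 ≠ 0 := by simpa using hε
  -- a bounded continuous approximant
  have hind : MemLp (s.indicator fun _ => c) 2 ν :=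
    MemLp.of_bound ((measurable_const.indicator hs).aestronglyMeasurable) |c|
      (ae_of_all _ fun a => by
        rw [Real.norm_eq_abs]
        by_cases ha : a ∈ s <;> simp [ha, abs_nonneg])
  obtain ⟨g₀, hg₀, -⟩ := hind.exists_boundedContinuous_eLpNorm_sub_le ENNReal.ofNat_ne_top hε2
  -- a finitely supported uniform approximant of `g₀`
  obtain ⟨r, hr0, hrε⟩ := exists_between (pos_iff_ne_zero.2 hε2)
  have hrtop : r ≠ ∞ := ne_top_of_lt (hrε.trans_le le_top)
  have hrpos : 0 < r.toReal := ENNReal.toReal_pos hr0.ne' hrtop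
  obtain ⟨I, hI⟩ := exists_finite_uniform_approx g₀.continuous (1 : ↥S → G) hrpos
  set g : (↥S → G) → ℝ := fun a => g₀ (fun i => if i ∈ I then a i else (1 : ↥S → G) i) with hgdef
  have hgc : Continuous g := g₀.continuous.comp (continuous_pi fun i => by
    by_cases hi : i ∈ I
    · simp only [hi, ↓reduceIte]; exact continuous_apply i
    · simp only [hi, ↓reduceIte]; exact continuous_const)
  have hgP : IsFinCylinder S g := by
    refine ⟨⟨I, fun a b hab => ?_⟩, hgc, ‖g₀‖, fun a => ?_⟩
    · simp only [hgdef]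
      congr 1
      funext i
      by_cases hi : i ∈ I
      · simp only [hi, ↓reduceIte]; exact hab i (Finset.mem_coe.2 hi)
      · simp only [hi, ↓reduceIte]
    · have h := g₀.norm_coe_le_norm (fun i => if i ∈ I then a i else (1 : ↥S → G) i)
      rwa [Real.norm_eq_abs] at h
  have hg₀m : AEStronglyMeasurable (g₀ : (↥S → G) → ℝ) ν := g₀.continuous.aestronglyMeasurable
  have hgm : AEStronglyMeasurable g ν := hgc.aestronglyMeasurable
  have hindm : AEStronglyMeasurable (s.indicator fun _ => c) ν :=
    (measurable_const.indicator hs).aestronglyMeasurable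
  -- `‖g - g₀‖₂ ≤ r`
  have h1 : eLpNorm (g - (g₀ : (↥S → G) → ℝ)) 2 ν ≤ r := by
    have hb : ∀ᵐ a ∂ν, ‖(g - (g₀ : (↥S → G) → ℝ)) a‖ ≤ r.toReal := ae_of_all _ fun a => by
      rw [Pi.sub_apply, Real.norm_eq_abs, abs_sub_comm]
      exact (hI a).le
    refine (eLpNorm_le_of_ae_bound hb).trans ?_
    rw [measure_univ, ENNReal.one_rpow, one_mul, ENNReal.ofReal_toReal hrtop]
  refine ⟨g, ?_, hgP⟩
  have hsplit : g - s.indicator (fun _ => c) =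
      (g - (g₀ : (↥S → G) → ℝ)) + ((g₀ : (↥S → G) → ℝ) - s.indicator fun _ => c) := by
    funext a; simp only [Pi.sub_apply, Pi.add_apply]; ring
  rw [hsplit]
  refine (eLpNorm_add_le (hgm.sub hg₀m) (hg₀m.sub hindm) one_le_two).trans ?_
  rw [eLpNorm_sub_comm] at hg₀
  calc eLpNorm (g - (g₀ : (↥S → G) → ℝ)) 2 ν + eLpNorm ((g₀ : (↥S → G) → ℝ) - s.indicator fun _ => c) 2 ν
      ≤ ε / 2 + ε / 2 := add_le_add (h1.trans hrε.le) hg₀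
    _ = ε := ENNReal.add_halves ε

/-- **Density of bounded continuous cylinder observables among the `S`-supported ones, in `L²(μ)`.**
For a probability measure `μ` on `LGConfig d G`, a bounded measurable real observable `F` depending
only on the links of `S`, and `ε ≠ 0`, there is a bounded continuous cylinder observable `g`, also
depending only on the links of `S`, with `‖F - g‖_{L²(μ)} ≤ ε`. -/
theorem exists_continuous_cylinder_eLpNorm_sub_le (μ : Measure (LGConfig d G)) [IsProbabilityMeasure μ]
    (S : Set (ZdEdge d)) {F : LGConfig d G → ℝ} (hF : Measurable F) {C : ℝ} (hC : ∀ U, |F U| ≤ C)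
    (hFS : DependsOn F S) {ε : ℝ≥0∞} (hε : ε ≠ 0) :
    ∃ (g : LGConfig d G → ℝ) (T : Finset (ZdEdge d)), IsCylinder g T ∧ Continuous g ∧
      (∃ C' : ℝ, ∀ U, |g U| ≤ C') ∧ DependsOn g S ∧ eLpNorm (F - g) 2 μ ≤ ε := by
  classical
  set ν : Measure (↥S → G) := μ.map S.restrict with hν
  haveI : IsProbabilityMeasure ν :=
    Measure.isProbabilityMeasure_map (measurable_setRestrict S).aemeasurable
  set Ft : (↥S → G) → ℝ := fun V => F (setGlue S V 1) with hFt
  have hFtm : Measurable Ft := hF.comp (measurable_setGlue S 1)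
  have hFt_mem : MemLp Ft 2 ν :=
    MemLp.of_bound hFtm.aestronglyMeasurable C (ae_of_all _ fun V => by
      rw [Real.norm_eq_abs]; exact hC _)
  obtain ⟨gt, hgt, ⟨I, hI⟩, hgtc, C', hC'⟩ := MemLp.induction_dense (μ := ν) (p := 2)
    ENNReal.ofNat_ne_top (IsFinCylinder S)
    (fun c s hs _ ε' hε' => exists_isFinCylinder_indicator_approx S ν c hs hε')
    (fun f g hf hg => hf.add hg) (fun f hf => hf.2.1.aestronglyMeasurable) hFt_mem hε
  refine ⟨gt ∘ S.restrict, I.image Subtype.val, ?_,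
    hgtc.comp (continuous_pi fun e => continuous_apply _), ⟨C', fun U => hC' _⟩, ?_, ?_⟩
  · intro U V hUV
    simp only [Function.comp_apply]
    apply hI
    intro i hi
    exact hUV i.1 (Finset.mem_coe.2 (Finset.mem_image_of_mem _ (Finset.mem_coe.1 hi)))
  · intro U V hUV
    simp only [Function.comp_apply]
    congr 1
    funext e
    exact hUV e.1 e.2
  · have hFeq : F = Ft ∘ S.restrict := funext fun U => (apply_setGlue_restrict S hFS 1 U).symm
    have hsub : (Ft ∘ S.restrict - gt ∘ S.restrict : LGConfig d G → ℝ) =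
        (Ft - gt) ∘ (S.restrict : LGConfig d G → (↥S → G)) := rfl
    rw [hFeq, hsub, ← eLpNorm_map_measure ((hFtm.aestronglyMeasurable).sub hgtc.aestronglyMeasurable)
      (measurable_setRestrict S).aemeasurable]
    exact hgt

end Density

end Summit.QuantumFields.GaugeBoot
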